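import Summits.ValiantsHypothesis.ValiantsHypothesis.Theorems.BarrierLeverPartitionMinorsMooreBenchEntries
import Summits.ValiantsHypothesis.ValiantsHypothesis.Theorems.BarrierLeverPartitionMinorsMooreBenchToolkit

/-!
# Route BarrierLever — item 20172 (CPM), benchmark row 14: the hierarchical Moore peel, STAGE
# REDUCTION I — substitution, scaling of the attached rows and reduction against the fixed rows

Helper file (`--supports stmt-ValiantsHypothesis-20172`; cell valiant-natproofs, rung V4, 𝒟-side of
door (c), benchmark «row 14», duty (iv); seat valiant-natproofs-prover gen 14).  Closes NO item.
Source: planner p1 g18, `HOME/p1/g18/MEMO-g18.md` §2.3, in linear-independence form.  One auxiliary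
definition: `reducedRow r i n Y` — the rows alive at stage `(i, n+1)` AFTER the one-point
substitution `Y_n ↦ X`, the scaling of the attached rows `(T_j, {n})` by `X^j`, and the reduction
against the fixed rows (closed forms of `…MooreBenchEntries`): fixed rows are the constants
`C ∘ rowVec r Y x`; `(T_j, {n}) ↦ (col ↦ [c_i ≤ col] · C(G̃[j, col]) · X^col)`;
`(∅, {b, n}) ↦ (col ↦ Σ_{d ⊆ T_col, bin d ≥ i} C(|T∖d|! · Y_b^{bin(T∖d)} · |d|!) · X^{bin d})`.

* `linearIndependent_rowVec_of_reduced` — over any commutative ring `R`: if the reduced rows are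
  linearly independent over `R[X]`, then so are the substituted rows `rowVec r Z`, for every node
  table `Z` with `Z n = X` and `Z b = C (Y b)` (`b < n`) (toolkit: `linearIndependent_of_block` with
  the diagonal `X^j`, `linearIndependent_of_sub_fixed`).

WHAT THIS IS NOT: the leading-term analysis (file `…MooreBenchLead`) and Theorem A (file
`…MooreBenchPeel`); nothing on items 20172 / 20195 / 19717, crux stmt-ValiantsHypothesis-14610, or
`VP` versus `VNP`.
-/

set_option linter.dupNamespace false

namespace Summit.ValiantsHypothesis.ValiantsHypothesis.Theorems.BarrierLever.MoorePeel

open Polynomial Finset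

/-- Row reduction against fixed rows, with the subtracted rows given by a family `e : L → K` landing
in the fixed set (a repackaging of `linearIndependent_of_sub_fixed`). -/
theorem linearIndependent_of_sub_fixed' {S : Type*} [CommRing S] {M : Type*} [AddCommGroup M]
    [Module S M] {K : Type*} [Fintype K] [DecidableEq K] {L : Type*} [Fintype L]
    (v : K → M) (F : Finset K) (e : L → K) (he : ∀ l, e l ∈ F) (π : K → L → S)
    (h : LinearIndependent S (fun k => if k ∈ F then v k else v k - ∑ l, π k l • v (e l))) :
    LinearIndependent S v := by
  classical
  apply linearIndependent_of_sub_fixed v F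
    (fun k l' => ∑ l ∈ Finset.univ.filter (fun l => e l = l'), π k l)
  have e1 : ∀ k, ∑ l' ∈ F, (∑ l ∈ Finset.univ.filter (fun l => e l = l'), π k l) • v l' =
      ∑ l, π k l • v (e l) := by
    intro k
    rw [← Finset.sum_fiberwise_of_maps_to (s := Finset.univ) (t := F) (g := e) (fun l _ => he l)
      (f := fun l => π k l • v (e l))]
    refine Finset.sum_congr rfl fun l' _ => ?_
    rw [Finset.sum_smul]
    refine Finset.sum_congr rfl fun l hl => ?_
    rw [(Finset.mem_filter.mp hl).2]
  have e2 : (fun k => if k ∈ F then v k else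
      v k - ∑ l' ∈ F, (∑ l ∈ Finset.univ.filter (fun l => e l = l'), π k l) • v l') =
      (fun k => if k ∈ F then v k else v k - ∑ l, π k l • v (e l)) := by
    funext k
    rw [e1 k]
  rw [e2]
  exact h


/-- **The reduced rows at stage `(i, n+1)`** (memo §2.3, after substitution, scaling and reduction
against the fixed rows; see the module docstring). -/
noncomputable def reducedRow {R : Type*} [CommRing R] (r i n : ℕ) (Y : ℕ → R) :
    RowLabel → (Fin r → R[X]) := fun x col =>
  Sum.elim (fun m => C (rowVec r Y (Sum.inl m) col))
    (Sum.elim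
      (fun jb : ℕ × ℕ => if jb.2 = n then
          (if (col : ℕ) < windowStart i then 0 else
            C ((inclFactorial jb.1 (col : ℕ) : R)) * X ^ (col : ℕ))
        else C (rowVec r Y (Sum.inr (Sum.inl jb)) col))
      (fun bb : ℕ × ℕ => if bb.2 = n then
          ∑ d ∈ (bits (col : ℕ)).powerset.filter (fun d => i ≤ bin d),
            C ((((bits (col : ℕ)) \ d).card.factorial : R) * Y bb.1 ^ bin (bits (col : ℕ) \ d) *
              (d.card.factorial : R)) * X ^ bin d
        else C (rowVec r Y (Sum.inr (Sum.inr bb)) col)))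
    x

section Reduced

variable {R : Type*} [CommRing R] (r i n : ℕ) (Y : ℕ → R)

/-- Reduced fixed rows are constants. -/
theorem reducedRow_of_mem (x : RowLabel) (hx : x ∈ stageRows i n) :
    reducedRow r i n Y x = fun col => C (rowVec r Y x col) := by
  funext col
  rcases x with m | ⟨j, b⟩ | ⟨b, b'⟩
  · rfl
  · have hb : b ≠ n := ne_of_lt (inr_inl_mem_stageRows.mp hx).2
    simp [reducedRow, hb]
  · have hb : b' ≠ n := ne_of_lt (inr_inr_mem_stageRows.mp hx).2
    simp [reducedRow, hb]

/-- Reduced attached rows of the peeled point. -/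
theorem reducedRow_alpha (j : ℕ) :
    reducedRow r i n Y (Sum.inr (Sum.inl (j, n))) = fun col : Fin r =>
      if (col : ℕ) < windowStart i then 0 else C ((inclFactorial j (col : ℕ) : R)) * X ^ (col : ℕ) := by
  funext col
  simp [reducedRow]

/-- Reduced pair rows through the peeled point. -/
theorem reducedRow_beta (b : ℕ) :
    reducedRow r i n Y (Sum.inr (Sum.inr (b, n))) = fun col : Fin r =>
      ∑ d ∈ (bits (col : ℕ)).powerset.filter (fun d => i ≤ bin d),
        C ((((bits (col : ℕ)) \ d).card.factorial : R) * Y b ^ bin (bits (col : ℕ) \ d) *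
          (d.card.factorial : R)) * X ^ bin d := by
  funext col
  simp [reducedRow]

end Reduced

/-- **STAGE REDUCTION I.**  Over any commutative ring `R`: if the reduced rows `reducedRow r i n Y`
at stage `(i, n+1)` are linearly independent over `R[X]`, then so are the substituted rows
`rowVec r Z` for every node table `Z` with `Z n = X` and `Z b = C (Y b)` for `b < n`. -/
theorem linearIndependent_rowVec_of_reduced {R : Type*} [CommRing R] (r i n : ℕ) (Y : ℕ → R)
    (Z : ℕ → R[X]) (hZn : Z n = X) (hZlt : ∀ b, b < n → Z b = C (Y b))
    (hred : LinearIndependent R[X]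
      (fun x : ↥(stageRows i (n + 1)) => reducedRow r i n Y (x : RowLabel))) :
    LinearIndependent R[X] (fun x : ↥(stageRows i (n + 1)) => rowVec r Z (x : RowLabel)) := by
  classical
  -- the three kinds of labels alive at stage `(i, n+1)`
  set ι₁ : Fin i → ↥(stageRows i (n + 1)) := fun j =>
    ⟨Sum.inr (Sum.inl ((j : ℕ), n)), inr_inl_mem_stageRows.mpr ⟨j.2, Nat.lt_succ_self n⟩⟩ with hι₁
  set ι₂ : Fin n → ↥(stageRows i (n + 1)) := fun b =>
    ⟨Sum.inr (Sum.inr ((b : ℕ), n)), inr_inr_mem_stageRows.mpr ⟨b.2, Nat.lt_succ_self n⟩⟩ with hι₂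
  have hι₁inj : Function.Injective ι₁ := by
    intro j j' e
    have := congrArg Subtype.val e
    simp only [hι₁, Sum.inr.injEq, Sum.inl.injEq, Prod.mk.injEq] at this
    exact Fin.ext this.1
  have htri : ∀ x : ↥(stageRows i (n + 1)), (x : RowLabel) ∈ stageRows i n ∨
      (∃ j', x = ι₁ j') ∨ (∃ b : Fin n, x = ι₂ b) := by
    rintro ⟨x, hx⟩
    rcases x with m | ⟨j, b⟩ | ⟨b, b'⟩
    · exact Or.inl (inl_mem_stageRows.mpr (inl_mem_stageRows.mp hx))
    · obtain ⟨hj, hb⟩ := inr_inl_mem_stageRows.mp hx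
      rcases Nat.lt_succ_iff_lt_or_eq.mp hb with hb | rfl
      · exact Or.inl (inr_inl_mem_stageRows.mpr ⟨hj, hb⟩)
      · exact Or.inr (Or.inl ⟨⟨j, hj⟩, rfl⟩)
    · obtain ⟨hbb, hb'⟩ := inr_inr_mem_stageRows.mp hx
      rcases Nat.lt_succ_iff_lt_or_eq.mp hb' with hb' | rfl
      · exact Or.inl (inr_inr_mem_stageRows.mpr ⟨hbb, hb'⟩)
      · exact Or.inr (Or.inr ⟨⟨b, hbb⟩, rfl⟩)
  have hι₁_not_fixed : ∀ j', ((ι₁ j' : ↥(stageRows i (n + 1))) : RowLabel) ∉ stageRows i n := by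
    intro j' hmem
    exact lt_irrefl n (inr_inl_mem_stageRows.mp hmem).2
  have hι₂_not_fixed : ∀ b, ((ι₂ b : ↥(stageRows i (n + 1))) : RowLabel) ∉ stageRows i n := by
    intro b hmem
    exact lt_irrefl n (inr_inr_mem_stageRows.mp hmem).2
  have hι₂val : ∀ b, ((ι₂ b : ↥(stageRows i (n + 1))) : RowLabel) = Sum.inr (Sum.inr ((b : ℕ), n)) :=
    fun b => rfl
  have hι₂_not_range : ∀ b, ι₂ b ∉ Set.range ι₁ := by
    rintro b ⟨j, e⟩
    have := congrArg Subtype.val e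
    simp [hι₁, hι₂] at this
  have hfixed_not_range : ∀ x : ↥(stageRows i (n + 1)), (x : RowLabel) ∈ stageRows i n →
      x ∉ Set.range ι₁ := by
    rintro x hx ⟨j, rfl⟩
    exact hι₁_not_fixed j hx
  -- STEP 1: scale the attached rows of the peeled point by `X^j`
  obtain ⟨V1, hV1⟩ : ∃ V1 : ↥(stageRows i (n + 1)) → Fin (r) →
      R[X], ∀ x, V1 x =
      (Sum.elim (fun _ => (1 : R[X]))
        (Sum.elim (fun jb : ℕ × ℕ => if jb.2 = n then Polynomial.X ^ jb.1 else 1) (fun _ => 1))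
        (x : RowLabel)) • rowVec (r) Z (x : RowLabel) := ⟨_, fun _ => rfl⟩
  have hV1α : ∀ j', V1 (ι₁ j') = (Polynomial.X : R[X]) ^ (j' : ℕ) •
      rowVec (r) Z (Sum.inr (Sum.inl ((j' : ℕ), n))) := by
    intro j'
    rw [hV1]
    simp [hι₁]
  have hV1off : ∀ x, x ∉ Set.range ι₁ → V1 x = rowVec (r) Z (x : RowLabel) := by
    intro x hx
    rw [hV1]
    rcases htri x with hfx | ⟨j', rfl⟩ | ⟨b, rfl⟩
    · obtain ⟨y, hy⟩ := x
      rcases y with m | ⟨j, b⟩ | ⟨b, b'⟩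
      · simp
      · have hb : b ≠ n := ne_of_lt (inr_inl_mem_stageRows.mp hfx).2
        simp [hb]
      · simp
    · exact absurd (Set.mem_range_self j') hx
    · simp [hι₂]
  apply linearIndependent_of_block _ V1 ι₁ hι₁inj
    (Matrix.diagonal fun j : Fin i => (Polynomial.X : R[X]) ^ (j : ℕ))
    (Matrix.diagonal fun j : Fin i => Polynomial.X ^ (i - (j : ℕ))) (Polynomial.X ^ i)
    (fun x hx => (Polynomial.monic_X_pow i).mul_right_eq_zero_iff.mp hx)
  · rw [Matrix.diagonal_mul_diagonal]
    ext j j'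
    simp only [Matrix.diagonal_apply, Matrix.smul_apply, Matrix.one_apply, smul_eq_mul, mul_ite,
      mul_one, mul_zero]
    split_ifs with hjj
    · rw [← pow_add, Nat.sub_add_cancel (le_of_lt j.2)]
    · rfl
  · intro j'
    rw [hV1α]
    have hdiag : ∀ j : Fin i,
        (Matrix.diagonal (fun j : Fin i => (Polynomial.X : R[X]) ^
          (j : ℕ)) j' j) • (fun c => rowVec (r) Z
            ((ι₁ j : ↥(stageRows i (n + 1))) : RowLabel) c) =
        if j = j' then (Polynomial.X : R[X]) ^ (j' : ℕ) •
          rowVec (r) Z (Sum.inr (Sum.inl ((j' : ℕ), n))) else 0 := by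
      intro j
      by_cases hj : j = j'
      · subst hj
        rw [Matrix.diagonal_apply_eq, if_pos rfl]
      · rw [Matrix.diagonal_apply_ne _ (Ne.symm hj), zero_smul, if_neg hj]
    rw [Finset.sum_congr rfl (fun j _ => hdiag j), Finset.sum_ite_eq' Finset.univ j',
      if_pos (Finset.mem_univ _)]
  · exact hV1off
  -- STEP 2: subtract the fixed rows (monomial rows `e_m`, attached rows `(T_j', {b})`)
  set F : Finset ↥(stageRows i (n + 1)) :=
    Finset.univ.filter fun x => (x : RowLabel) ∈ stageRows i n with hF
  have hmemF : ∀ x : ↥(stageRows i (n + 1)), x ∈ F ↔ (x : RowLabel) ∈ stageRows i n := fun x => by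
    simp [hF]
  set eL : Fin (windowStart i) ⊕ (Fin i × Fin n) → ↥(stageRows i (n + 1)) := fun l =>
    Sum.elim (fun m : Fin (windowStart i) =>
        (⟨Sum.inl (m : ℕ), inl_mem_stageRows.mpr m.2⟩ : ↥(stageRows i (n + 1))))
      (fun jb : Fin i × Fin n => (⟨Sum.inr (Sum.inl ((jb.1 : ℕ), (jb.2 : ℕ))),
        inr_inl_mem_stageRows.mpr ⟨jb.1.2, Nat.lt_succ_of_lt jb.2.2⟩⟩ : ↥(stageRows i (n + 1))))
      l with heL
  have heF : ∀ l, eL l ∈ F := by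
    intro l
    rw [hmemF]
    rcases l with m | ⟨j, b⟩
    · simp only [heL, Sum.elim_inl]
      exact inl_mem_stageRows.mpr m.2
    · simp only [heL, Sum.elim_inr]
      exact inr_inl_mem_stageRows.mpr ⟨j.2, b.2⟩
  obtain ⟨π, hπ⟩ : ∃ π : ↥(stageRows i (n + 1)) → Fin (windowStart i) ⊕ (Fin i × Fin n) →
      R[X], ∀ x l, π x l =
      Sum.elim (fun _ => (0 : R[X]))
        (Sum.elim
          (fun jb : ℕ × ℕ => if jb.2 = n then
            Sum.elim (fun m : Fin (windowStart i) =>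
              Polynomial.C ((inclFactorial jb.1 (m : ℕ) : R)) *
                Polynomial.X ^ (m : ℕ))
              (fun _ => 0) l else 0)
          (fun bb : ℕ × ℕ => if bb.2 = n then
            Sum.elim (fun _ => (0 : R[X]))
              (fun jb' : Fin i × Fin n => if (jb'.2 : ℕ) = bb.1 then
                Polynomial.C (((bits (jb'.1 : ℕ)).card.factorial : R)) *
                  Polynomial.X ^ (jb'.1 : ℕ) else 0) l else 0))
        (x : RowLabel) := ⟨_, fun _ _ => rfl⟩
  obtain ⟨V2, hV2⟩ : ∃ V2 : ↥(stageRows i (n + 1)) → Fin (r) →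
      R[X],
      ∀ x, V2 x = if x ∈ F then V1 x else V1 x - ∑ l, π x l • V1 (eL l) := ⟨_, fun _ => rfl⟩
  apply linearIndependent_of_sub_fixed' V1 F eL heF π
  rw [show (fun k => if k ∈ F then V1 k else V1 k - ∑ l, π k l • V1 (eL l)) = V2 from
    (funext hV2).symm]
  -- closed forms of the reduced rows
  have hV2fixed : ∀ x : ↥(stageRows i (n + 1)), (x : RowLabel) ∈ stageRows i n →
      V2 x = fun col => Polynomial.C (rowVec (r) (Y) (x : RowLabel) col) := by
    intro x hx
    rw [hV2, if_pos ((hmemF x).mpr hx), hV1off x (hfixed_not_range x hx)]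
    funext col
    exact rowVec_eq_C_of_mem_stageRows _ (Y) Z i n hZlt x hx col
  have hV2α : ∀ j' : Fin i, V2 (ι₁ j') = fun col : Fin (r) =>
      if (col : ℕ) < windowStart i then 0 else
        Polynomial.C ((inclFactorial (j' : ℕ) (col : ℕ) : R)) *
          Polynomial.X ^ (col : ℕ) := by
    intro j'
    rw [hV2, if_neg (fun hm => hι₁_not_fixed j' ((hmemF _).mp hm)), hV1α]
    funext col
    rw [← rowVec_single_sub_fixed (r) Z n hZn i (j' : ℕ) col]
    simp only [Pi.sub_apply, Pi.smul_apply, Finset.sum_apply, smul_eq_mul]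
    congr 1
    rw [Fintype.sum_sum_type]
    have h2 : ∑ jb : Fin i × Fin n, π (ι₁ j') (Sum.inr jb) * V1 (eL (Sum.inr jb)) col = 0 :=
      Finset.sum_eq_zero fun jb _ => by rw [hπ]; simp [hι₁]
    rw [h2, add_zero, ← Fin.sum_univ_eq_sum_range (fun m =>
      (Polynomial.C ((inclFactorial (j' : ℕ) m : R)) * Polynomial.X ^ m) *
        (if (col : ℕ) = m then (1 : R[X]) else 0)) (windowStart i)]
    refine Finset.sum_congr rfl fun m _ => ?_
    have hmrange : eL (Sum.inl m) ∉ Set.range ι₁ := by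
      rintro ⟨j, e⟩
      have := congrArg Subtype.val e
      simp [hι₁, heL] at this
    rw [hπ, hV1off _ hmrange]
    simp [hι₁, heL, rowVec]
  have hV2β : ∀ b : Fin n, V2 (ι₂ b) = fun col : Fin (r) =>
      ∑ d ∈ (bits (col : ℕ)).powerset.filter (fun d => i ≤ bin d),
        Polynomial.C ((((bits (col : ℕ)) \ d).card.factorial : R) *
          Y (b : ℕ) ^ bin (bits (col : ℕ) \ d) * (d.card.factorial : R)) *
          Polynomial.X ^ bin d := by
    intro b
    rw [hV2, if_neg (fun hm => hι₂_not_fixed b ((hmemF _).mp hm)), hV1off _ (hι₂_not_range b)]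
    funext col
    rw [← rowVec_pair_sub_fixed (r) (Y) Z n (b : ℕ) i hZn
      (hZlt b b.2) col]
    simp only [hι₂val, Pi.sub_apply, Pi.smul_apply, Finset.sum_apply, smul_eq_mul]
    congr 1
    rw [Fintype.sum_sum_type]
    have h1 : ∑ m : Fin (windowStart i), π (ι₂ b) (Sum.inl m) * V1 (eL (Sum.inl m)) col = 0 :=
      Finset.sum_eq_zero fun m _ => by rw [hπ]; simp [hι₂]
    rw [h1, zero_add, Fintype.sum_prod_type]
    rw [← Fin.sum_univ_eq_sum_range (fun j' =>
      (Polynomial.C (((bits j').card.factorial : R)) * Polynomial.X ^ j') *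
        Polynomial.C (rowVec (r) (Y) (Sum.inr (Sum.inl (j', (b : ℕ)))) col)) i]
    refine Finset.sum_congr rfl fun j' _ => ?_
    have hval : ∀ b' : Fin n, π (ι₂ b) (Sum.inr (j', b')) * V1 (eL (Sum.inr (j', b'))) col =
        if b' = b then (Polynomial.C (((bits (j' : ℕ)).card.factorial : R)) *
          Polynomial.X ^ (j' : ℕ)) * Polynomial.C (rowVec (r) (Y)
            (Sum.inr (Sum.inl ((j' : ℕ), (b : ℕ)))) col) else 0 := by
      intro b'
      have hmrange : eL (Sum.inr (j', b')) ∉ Set.range ι₁ := by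
        rintro ⟨j, e⟩
        have := congrArg Subtype.val e
        simp only [hι₁, heL, Sum.elim_inr, Sum.inr.injEq, Sum.inl.injEq,
          Prod.mk.injEq] at this
        exact absurd this.2 (ne_of_gt b'.2)
      rw [hπ, hV1off _ hmrange]
      simp only [hι₂, heL, Sum.elim_inr]
      by_cases hb' : b' = b
      · subst hb'
        rw [rowVec_eq_C_of_mem_stageRows _ (Y) Z i n hZlt _
          (inr_inl_mem_stageRows.mpr ⟨j'.2, b'.2⟩) col]
        simp
      · simp [hb', Fin.val_inj]
    simp_rw [hval]
    rw [Finset.sum_ite_eq' Finset.univ b, if_pos (Finset.mem_univ _)]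
  -- the reduced family is `reducedRow`
  have hV2eq : V2 = fun x : ↥(stageRows i (n + 1)) => reducedRow r i n Y (x : RowLabel) := by
    funext x
    rcases htri x with hx | ⟨j', rfl⟩ | ⟨b, rfl⟩
    · rw [hV2fixed x hx, reducedRow_of_mem r i n Y _ hx]
    · rw [hV2α, reducedRow_alpha]
    · rw [hV2β, hι₂val, reducedRow_beta]
  rw [hV2eq]
  exact hred

end Summit.ValiantsHypothesis.ValiantsHypothesis.Theorems.BarrierLever.MoorePeel
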